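import Mathlib
import HarnessLib
import HarnessLib.Audit
import Summits.AtomisticToContinuum.Statement
import Literature.MathematicalPhysics.QuantumManyBody.PeriodicBoseGas
import HarnessLib.Audit.Status.Attr

/-!
Route: BECNoCheapMomentum

DORMANT since 2026-08-25T01:34:39Z (reconciler: no traction for 7.3 d (last activity item-evidence-added at 2026-08-17T18:55:01Z); parked, not closed — `ledger route dormant route-AtomisticToContinuum-BECNoCheapMomentum --off` to reacti) — unstaffed, not closed; items shared with open routes are served there. `ledger route dormant <id> --off` reactivates.

# Route BECNoCheapMomentum — no cheap momentum sharing — a κk² particle–hole sector-gap floor turns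
the Wagner–Feynman bound into n_k ≤ (k²+2ρ‖v‖₁)/Γ and type-I BEC by mode counting

It suffices to show X = SectorGapFloor ∧ HardCoreMomentBound ∧ BoundaryTransferWeak (card
sector-gap-no-cheap-momentum, "no cheap
momentum sharing", NCMS_κ). This is the CONFORMING re-file (D-0027 §2.1) of
route-AtomisticToContinuum-BECSectorGap, retired
2026-08-15 `not-a-thesis` only because its assembly named the Literature decl instead of the
Statement abbrev: same seven items, new
deciding theorem `closes : … → BoseEinsteinCondensation` (rc 0, axioms
propext/Classical.choice/Quot.sound in Sketch.lean).
SectorGapFloor: for every repulsive finite-range v with ∫v ≠ 0 and every window constant C > 0 there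
are κ, ρ₀ > 0 such that for
ρ < ρ₀, all large N (torus of side L = (N/ρ)^(1/3)) and every k ≠ 0 with ‖k‖² ≤ Cρ the PARTICLE–HOLE
SECTOR GAP
Γ_N(k) := E_(N+1)(k) + E_(N−1)(k) − 2E₀(N) is ≥ 2κ‖k‖², where E_M(k) = inf of the periodic M-body
energy over Bloch states
Ψ(X + s𝟙) = e^(ik·s)Ψ(X) (= E₀(M) + ε^(L,M)(k), the infimum of the energy–momentum spectrum of
CorneanDerezinskiZin2009; ⊤ off the
dual lattice). Given it, the Wagner–Feynman moment bound read backwards, n_k·Γ_N(k) ≤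
⟨[[a_k,H],a_k†]⟩ ≤ k² + 2ρ‖v‖₁, plus
Parseval and a d = 3 lattice count give constant-mode occupation ≥ N/2 on the torus for integrable v
(support
MomentBoundCondensation, provable now, operator-free); non-integrable cores need the Jastrow-dressed
version (crux
HardCoreMomentBound); the shared crux BoundaryTransferWeak (stmt-AtomisticToContinuum-0827) carries
torus ⇒ Dirichlet.
Lean: `SectorGapFloor ∧ HardCoreMomentBound ∧ BoundaryTransferWeak`

## Assembly
Pure logic (rc 0 in Sketch.lean; axioms propext / Classical.choice / Quot.sound): fix v repulsive
finite-range; trichotomy on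
∫v(|x|)dx ∈ {0}, (0,∞), {∞}: FreeGasCondensation, resp. MomentBoundCondensation fed with
ZeroMomentumGround and SectorGapFloor,
resp. HardCoreMomentBound fed with SectorGapFloor, give the PeriodicBEC body for v;
BoundaryTransferWeak turns it into
∃ρ₀ ∀ρ<ρ₀ HasGroundStateBEC v ρ, i.e. the sub-problem Statement decl `BoseEinsteinCondensation`
(root abbrev, by name).
Deciding theorem (glue.lean, verbatim): `theorem closes (h1 : SectorGapFloor) (h2 :
HardCoreMomentBound) (h3 : BoundaryTransferWeak)
(h4 : ZeroMomentumGround) (h5 : MomentBoundCondensation) (h6 : FreeGasCondensation) :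
BoseEinsteinCondensation` by `intro v hv; refine
h3 v hv ?_; by_cases h0 : ∫⁻ v‖x‖ = 0; exact h6 …; by_cases htop : ∫⁻ v‖x‖ = ⊤; exact h2 v hv htop
(h1 v hv h0); exact h5 v hv htop
h0 (h4 v hv htop) (h1 v hv h0)`.

Rationale: WHY THIS LINE. Mechanism (Wagner1966; Stringari1995 eq. (16) "Feynman bound", PDF p. 75;
PitaevskiiStringari1991; Roepstorff1978): for a P = 0 state
Φ of N bosons on the torus, a_kΦ and a_k†Φ lie in the momentum ∓k sectors of N∓1 particles, so
n_k[E_(N−1)(k) − E₀(N)] +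
(n_k+1)[E_(N+1)(k) − E₀(N)] ≤ ⟨[[a_k,H],a_k†]⟩_Φ (+ a form error that vanishes for an eigenstate and
is o_δ(1) at fixed N for
δ-near-minimisers), and the CCR collapse the double commutator to k² + ρv̂(0) + L⁻³Σ_q v̂(k−q)n_q ≤
k² + 2ρ‖v‖₁: a LOWER bound on
sector energies is an UPPER (infrared) bound n_k ≤ (k² + 2ρ‖v‖₁)/Γ_N(k), Bogoliubov-saturated up to
a factor 2, the chemical
potentials cancelling between the hole and the particle channel. The hypothesis is a finite-volume,
quadratic-floor weakening of
Landau's criterion = CorneanDerezinskiZin2009 Conj. 1.1(3)/2.2 (c_crit > 0, d ≥ 2), asked only on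
‖k‖ ≤ (Cρ)^(1/2), where Galilei
boosts / umklapp (ibid. §2.3: c_crit^(L,n) ≤ π/L, at |k| ~ 2πρL²) and vortex rings (|k| ≳ 1/a,
JonesRoberts1982) are absent, and
at the bottom k = 2π/L it tolerates a free-particle-size gap κ(2π/L)². Imported: sum rules / the
joint energy–momentum spectrum
(many-body spectral theory), used against the INFIMUM of a symmetry sector instead of as an upper
bound on excitation energies;
for attacking the crux, the ground-state transform ε^(L,N)(k) = sectorial Poincaré constant of μ =
Ψ₀² (functional inequalities) —
route BECSectorPoincareTwoScale PRODUCES a linear Landau floor which implies SectorGapFloor verbatim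
through its glue
LandauFloorToSectorGap (stmt-AtomisticToContinuum-9096) + EnergyConvexityWindow (9094), so this
route is the CONSUMER end of that
junction, staffed independently of the two-scale bet and of how the floor is proved. Versus other
open routes: BECInfraredBound
wants n_k ≲ √ρ/|k| as a crux with no mechanism, BECPhononFloor an order relation among shell
occupations; here the IR bound is
DERIVED from one gauge-invariant min–max quantity — no reflection positivity, no S(k), no vertex, no
energy asymptotics beyond
E₀ ≤ ½ρ‖v‖₁N — and δ is chosen after N, below every Galilei-boost window
(KineticGapLengthScalesNarrow). Negatives index (6
entries; the one BEC entry is the SwapJensen positivity inequality, stmt-3980) is not touched by any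
item.

RANKED CRUXES. #2 SectorGapFloor (crux) — NCMS_κ, particle–hole form (card N1): for every repulsive
finite-range v with ∫v(|x|)dx ≠ 0 and every C > 0 there are κ > 0, ρ₀ > 0 such that for ρ ∈ (0,ρ₀),
eventually in N, for every k ≠ 0 with ‖k‖² ≤ Cρ: 2E₀^per(N,L) + 2κ‖k‖² ≤ E^per_(N+1)(k;L) +
E^per_(N−1)(k;L), L = (N/ρ)^(1/3), E^per_M(k;L) = inf periodicEnergy over Bloch-k periodic M-body
states (⊤ off the dual lattice, so only k ∈ (2π/L)ℤ³ bind). Bogoliubov value: Γ ≈ 2c_s|k| + 8πa/L³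
on the window (c_s = (16πaρ)^(1/2); multi-phonon hull), so κ = ½(16πa/C)^(1/2) works; the free gas
(Γ = 4π|k|/L) is correctly excluded by ∫v ≠ 0. Verbatim the signature of retired stmt-5149 and of
the conclusion of BECSectorPoincareTwoScale.LandauFloorToSectorGap (stmt-9096). [difficulty:
open-problem] (why it might fail: A TL spectral floor uniform in L: rigorous sector spectra exist
only in GP/mean-field scaling (BoccatoEtAl2019Acta; BrenneckeCaporalettiSchlein2022 'still open');
hides near-convexity E₀(N+1)+E₀(N−1)−2E₀(N) ≥ −o(c_s/L); dies on any soft non-phonon branch or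
c.o.m. tower with Γ/k² → 0 in the window.) [CorneanDerezinskiZin2009, Stringari1995,
BoccatoEtAl2019Acta, BrenneckeCaporalettiSchlein2022, Seiringer2011, DerezinskiNapiorkowski2014,
LSSY2005]
#3 HardCoreMomentBound (crux) — the non-integrable case of the chain (card N2 hard-core flag): for
repulsive finite-range v with ∫v(|x|)dx = ∞ (hard cores, r^(−3)-type cores), the SectorGapFloor
conclusion for v implies the PeriodicBEC body for v (constant-mode occupation ≥ cN for
δ-near-minimisers on the torus of side (N/ρ)^(1/3), all small ρ, δ after N). Intended proof: replace
a_k† by the Jastrow/Dyson-dressed creation a†(φ_k ∏_j f(x−x_j)) (zero-energy scattering solution f,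
cut at a ≪ R ≪ ρ^(−1/3)) so that the dressed double commutator is ≤ k²(1+CρR³) + Cρa, bound the
dressed occupations by the sector gap as in the soft case, control |n₀ − ñ₀| ≤ CN(ρR³)^(1/2), and
take the UV tail from a Dyson-type bound E₀ ≤ CρaN (LSSY2005 Thm 2.2); zero-momentum uniqueness of
the hard-core torus ground state at low density (connected configuration space) is part of the item.
[deps: SectorGapFloor] [difficulty: L] (why it might fail: Bare a_k†Ψ₀ leaves the form domain
(⟨[[a,V],a†]⟩ = ρv̂(0) = ∞); the Jastrow-dressed double commutator has 3-body terms and [A,A†] ≠ 1,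
with no printed estimate uniform in N — the dressing error CN(ρR³)^{1/2} must beat N/2 with a ≪ R ≪
ρ^{−1/3}.) [LSSY2005, Dyson1957, Stringari1995, LiebSeiringerYngvason2000, LiebYngvason1998]
#4 BoundaryTransferWeak (crux) — shared verbatim with stmt-AtomisticToContinuum-0827
(BECPeriodicReduction / BECPhononFloor / BECSectorPoincareTwoScale …): for each repulsive
finite-range v, the PeriodicBEC body for v (torus of side (N/ρ)^(1/3), constant mode,
δ-near-minimisers, δ after N) implies ∃ρ₀ > 0 ∀ρ ∈ (0,ρ₀) HasGroundStateBEC v ρ (Dirichlet box,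
λ_max(γ) ≥ cN via condensateNumber). Not glue: expected proof by Neumann bracketing of interior
sub-boxes (−Δ_Dir ≥ ⊕−Δ_Neu, v ≥ 0) plus a mode-free criterion λ_max ≥ tr γ²/N; v ≡ 0: hypothesis
and conclusion both true. [difficulty: XL] (why it might fail: The torus hypothesis never fires on
the Dirichlet ground state (wall energy ≫ δ above E₀^per; interior restrictions are neither periodic
nor sharp-N): no energy-comparison proof; needs a structural transfer (Neumann bracketing +
mode-free λ_max ≥ tr γ²/N) not in print.) [LSSY2005, BoccatoSeiringer2023, Basti2022, Junge2026,
Robinson1976, Fournais2020]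
#9 ZeroMomentumGround (support) — qualitative zero-momentum gap at fixed (N, L) for integrable v
(Perron–Frobenius): for repulsive finite-range v with ∫v(|x|)dx < ∞, every N, every L > 0 and every
q ≠ 0, E₀^per(N,L) < E^per_N(q;L) (strict; ⊤ on the right off the dual lattice; N = 0 holds because
the Bloch-q class is empty). Proof: the constant state bounds E₀^per ≤ N(N−1)‖v‖₁/(2L³) < ∞; compact
resolvent on the torus and positivity-improving e^(−tH) for 0 ≤ V ∈ L¹_loc (ReedSimonIV1978
XIII.44–47, XIII.12; C¹ is a form core) ⇒ unique positive, hence Bose-symmetric and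
translation-invariant, ground state; a minimising Bloch-q sequence with energy → E₀ would converge
(compactness, lower semicontinuity) to a Bloch-q ground state, orthogonal to the Bloch-0 one —
contradiction. Heavy in Lean (no many-body operators in Mathlib) but no open mathematics; wanted
also by the positivity cards. [difficulty: XL] [ReedSimonIV1978, CorneanDerezinskiZin2009]
#9 MomentBoundCondensation (support) — the card's theorem-shaped half (N2+N3), integrable v ≢ 0:
ZeroMomentumGround-body(v) → SectorGapFloor-body(v) → PeriodicBEC-body(v) with c = 1/2. Proof
(operator-free, C¹-form level, δ chosen after N): decompose a δ-near-minimiser Ψ into centre-of-mass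
Fourier sectors Ψ = ΣΨ_q (C¹, form-orthogonal); ZMG and T ≥ |P|²/N give g_N := inf_(q≠0)(E_N(q) −
E₀) > 0 and Σ_(q≠0)‖Ψ_q‖² ≤ δ/g_N; for Φ = Ψ_0/‖Ψ_0‖ use the first-quantised a(φ_k), a†(φ_k) (as in
`occupation`): Q_(N−1)(aΦ) ≥ E_(N−1)(k)n_k (E_(N−1)(−k) = E_(N−1)(k) by conjugation), Q_(N+1)(a†Φ) ≥
E_(N+1)(k)(n_k+1) (and E_(N+1)(k) ≥ E₀(N+1) ≥ E₀(N) lets the extra +1 be dropped), the identity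
Q_(N−1)(aΦ) + Q_(N+1)(a†Φ) = ⟨[[a,H],a†]⟩_Φ + 2Re(Q_N − E₀)(Φ, n̂_kΦ) + (Q_N(Φ) − E₀) with the error
≤ 2(δ′·C(N,L,k,‖v‖₁))^(1/2) + δ′ by Cauchy–Schwarz for the non-negative form Q_N − E₀ (n̂_kΦ stays
in the form domain because v ∈ L¹), and ⟨[[a_k,H],a_k†]⟩_Φ = k² + L⁻³(v̂(0)N + Σ_q v̂(q−k)n_q) ≤ k²
+ 2ρ‖v‖₁; hence n_k ≤ (k² + 2ρ‖v‖₁ + err_k)/(2κk²) on the window C = 4‖v‖₁; Parseval Σ_k n_k = N,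
Σ_k k²n_k = T ≤ E₀ + δ′ ≤ ½ρ‖v‖₁N + δ′ (constant trial state) give the UV tail Σ_(|k|²>Cρ) n_k ≤ N/8
+ o(1), and the d = 3 lattice count (#{0<|k|≤K} ≈ K³L³/6π², Σ|k|⁻² ≈ KL³/2π²) gives the IR sum ≤
(5/3π²)‖v‖₁^(3/2)ρ^(1/2)N/κ + O(1); so n₀(Φ) ≥ 3N/4 for ρ < ρ₁(v,κ) and n₀(Ψ) ≥ (1 − δ/g_N)n₀(Φ) ≥
N/2. [difficulty: XL] [Stringari1995, Wagner1966, PitaevskiiStringari1991, Roepstorff1978,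
KennedyLiebShastry1988, CorneanDerezinskiZin2009]
#9 FreeGasCondensation (support) — the a.e.-free gas (∫v(|x|)dx = 0, where SectorGapFloor's
hypothesis fails and is not assumed) condenses on the torus: v^per = 0 a.e., so periodicEnergy =
kinetic energy and E₀^per = 0 (constant state); for a δ-near-minimiser Σ_(k≠0) n_k ≤ T(L/2π)² ≤
δL²/4π², so δ = 2π²/L² gives n₀ ≥ N − ½ ≥ N/2 (Parseval in one variable inside the product, Bessel
for the gradient); c = 1/2, any ρ₀. [difficulty: M] [LSSY2005, PenroseOnsager1956]

TWO-LAYER PLAN. Foreseen glued splits (none filed now; k ≤ 3, depth 1): SectorGapFloor ⇐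
OneSidedSectorFloor (ε^(L,N±1)(k) ≥ κ′k² on the window —
the card's original NCMS = CorneanDerezinskiZin2009's IES floor, quadratic version) → NearConvexity
(E₀(N+1)+E₀(N−1)−2E₀(N) ≥
−κ′(2π/L)² eventually; Bogoliubov: +8πa/L³) → SectorGapFloor. MomentBoundCondensation ⇐
MomentInequality (the sector-wise
inequality for P = 0 near-minimisers) → ModeCount (Parseval, UV Chebyshev, d = 3 lattice sums; pure
arithmetic, provable now) →
MomentBoundCondensation. HardCoreMomentBound ⇐ DysonUpperBound (E₀^per ≤ 4πρaN(1 + Ca/b), =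
Literature fact
LSSY2005_upperBound_periodic) → DressedMomentInequality → HardCoreMomentBound. JUNCTION (standing):
route
BECSectorPoincareTwoScale's LandauSectorBound (stmt-9091) + EnergyConvexityWindow (9094) give
SectorGapFloor's body through their
provable-now glue LandauFloorToSectorGap (9096); conversely their bridge LandauToPeriodicBEC (9095)
is a corollary of this route's
supports — the two routes share 0827 and should be tenured together. A direct attack on
OneSidedSectorFloor is expected through the
ground-state transform (ε^(L,N)(k) = inf{∫Σ_i|∇_iF|²Ψ₀² : F Bloch-k}/‖F‖²_(Ψ₀²)): sector-resolved
two-scale / Polchinski-flow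
Poincaré inequalities, or moving-frame stability H − w·P ≥ E₀ − O(Nw²)-type bounds on |P| ≤ K; the
Jastrow parent-Hamiltonian
anchor (card N4, route BECParentAnchor: diffusive sector gap Dk², BEC without phonons) is the
calibration case.

KILL CRITERIA. ¬SectorGapFloor — an admissible v ≢ 0 and densities ρ → 0 with Γ_N(k_N)/‖k_N‖² → 0
along window momenta (a soft non-phonon
branch, a centre-of-mass tower, or failure of near-convexity at order c_s/L) — closes the route
`refuted:SectorGapFloor` and
simultaneously kills BECSectorPoincareTwoScale's target (via 9096) and every Landau-line card
(landau-to-infrared-bound,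
swap-overlap S3). ¬HardCoreMomentBound with SectorGapFloor standing (only possible as ¬PeriodicBEC
for a hard-core v) forces a
pivot to a different hard-core device (softening at fixed scattering length + a monotonicity
statement) or closes the route, since
the conjunct quantifies over hard cores. ¬BoundaryTransferWeak kills this route and every torus
route alike (walls destroy a torus
condensate), not the conjunct. ¬ZeroMomentumGround or ¬FreeGasCondensation can only mean a
misformalised Bloch/sector clause —
restate (refuted-misstated), do not close. PeriodicBEC (the hypothesis body of 0827) proved by any
other route moots ranks 2–3
(close `superseded`).

NOT DECOMPOSED YET. How SectorGapFloor is proved (functional-inequality vs operator route; the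
near-convexity lemma; window bookkeeping at |k| ~ 1/a
for huge C, absorbed by shrinking ρ₀(C)) — layer-2 children only after a refuter pass. The internal
lemmas of MomentBoundCondensation
(first-quantised CCR algebra on C¹ functions, 3-torus Fourier series in one variable inside a
product, lattice-point counts, the
form Cauchy–Schwarz error, conjugation symmetry E(−k) = E(k)) ride as `--supports` helpers, never
items. The dressed-operator
algebra of HardCoreMomentBound and the Dyson upper bound. Generalised (ODLRO-type) condensation from
shell positivity (card N5) is
NOT filed: it does not assemble to the conjunct, and its 1-D calibration (Lieb1963 type-II branch:
sector gap O(1/L) at k = 2πρ)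
shows the window must stay below umklapp momenta. No T > 0, no d ≠ 3, canonical ensemble only.

CHEAPEST FALSIFIER. (i) Bogoliubov bookkeeping of the two-sided gap, done by hand: Γ_N(k) =
ω_(N+1)(k) + ω_(N−1)(k) + (μ_(N+1) − μ_N) with ω = subadditive
hull of √(k⁴+16πaρk²) = c_s|k|(1 + O((c_sL)⁻²)) and μ_(N+1) − μ_N = 8πa/L³ > 0, so Γ ≥ 2κk² on ‖k‖²
≤ Cρ iff κ ≤ (16πa/C)^(1/2) —
passes, ρ-uniformly, with κ = ½(16πa/C)^(1/2); the free gas fails it (Γ = 4π|k|/L), as the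
hypothesis ∫v ≠ 0 demands; boosts
(CorneanDerezinskiZin2009 §2.3, |k| = 2πρL²) and vortex rings (|k| ≳ 1/a, JonesRoberts1982) sit
outside the window for ρ < ρ₀(C).
(ii) The computation a refuter should run first (kit; not run here): exact diagonalisation of N =
3…8 lattice bosons (on-site U,
filling fixed) on 3-D tori 4³…8³: Γ_N(k_min)/k_min² and ε^(L,N±1)(k_min)/k_min² versus L — a
decreasing trend toward 0 at the lowest
shell flags a tower and kills the line cheaply. (iii) Lookup (re-run 2026-08-15): a printed LOWER
bound on ε^(L,n)(k) at fixed
density? CorneanDerezinskiZin2009 ("little rigorous work"), BrenneckeCaporalettiSchlein2022 p. 2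
("still open"), doi:10.4171/8ecm/04,
doi:10.1007/s00220-024-05199-w (GP regime and slightly beyond only) — none.

NUMBERS. Units ħ = 2m = 1. Bogoliubov: e(k) = √(k⁴+16πaρk²), c_s = (16πaρ)^(1/2) = 4(πaρ)^(1/2), μ =
8πaρ, ξ = (8πρa)^(−1/2), second
difference of E₀ in N: 8πa/L³; sector bottom ω_L(k) → c_s|k| (multi-phonon hull); n_k = v_k²
saturates n_k ≤ (k²+2ρv̂(0))/Γ up to
the factor (k²+2μ)/(k²+μ) ≤ 2. Window K² = Cρ; soft chain: C = 4‖v‖₁ (UV tail ≤ (½ρ‖v‖₁N+δ)/K² ≤ N/8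
+ o(N)); κ_Bog =
½(16πa/C)^(1/2) = (πa/‖v‖₁)^(1/2) ≤ 8^(−1/2) by Spruch–Rosenberg 8πa ≤ ‖v‖₁ (in tree:
four_pi_mul_scatteringLength_le); IR sum ≤
N ρ^(1/2)‖v‖₁^(3/2)[2/(3π²) + 1/π²]/κ from #{0<|k|≤K} ≈ K³L³/6π² and Σ|k|⁻² ≈ KL³/2π²; resulting
depletion bound O(‖v‖₁²(ρ/a)^(1/2))
versus Bogoliubov's (8/3√π)(ρa³)^(1/2). Free gas: Γ_free(k) = 4π|k|/L on axes (violates the floor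
for |k| > 2π/(κL)); boosts:
ε(2πρL²·ê) = 4π²ρL, c_crit^(L,n) ≤ π/L (CorneanDerezinskiZin2009 §2.3); Galilei-boost window of
KineticGapLengthScalesNarrow:
4π²N/L², while δ here → 0 at fixed N; vortex rings: p = 4π²ρR² ≥ 4π²ρξ² = π/(2a) for R ≥ ξ
(circulation quantum 4π in these units), with E/p → 0 only as R → ∞ (JonesRoberts1982) — outside the
window. Rigorous spectra: GP
regime only (BoccatoEtAl2019Acta: Σn_p√(|p|⁴+16πa p²) + O(N^(−1/4)) on the unit torus;
BrenneckeCaporalettiSchlein2022: κ ∈ (0,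
small)). Items at open: 7 (3 cruxes, 3 supports, 1 assembly).

DEFINITION REQUESTS. None blocking: the Bloch-sector infimum E^per_M(k;L) = ⨅ over
PeriodicTrialState M L with Ψ.ψ (X + s𝟙) = exp(i k·s)·Ψ.ψ X of
periodicEnergy is inlined in four items (rc 0). Nice-to-have (non-blocking, would shorten every
Landau-line item):
`momentumSectorEnergy v M L k` in Literature/MathematicalPhysics/QuantumManyBody/PeriodicBoseGas (=
E^(L,M) + ε^(L,M)(k) of
CorneanDerezinskiZin2009 (1.6)); plane-wave `cellOccupation` and Parseval
(PeriodicBoseGasFourier.tsum_sq_cellFourierCoeff) already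
exist; BECSectorPoincareTwoScale's D1 GroundStateDirichletForm serves the sectorial-Poincaré
reformulation. Literature want
inherited: Roepstorff1978 (doi:10.1007/bf01014310, paywalled, acq-02351).

Novelty: Searches (2026-08-15, this seat; local searchd rc 75 once, OpenAlex HTTP 429, galaxy substring legs
0 hits ×3): `lit frontier
AtomisticToContinuum --since 2023` (30 rows; BEC descendants arXiv:2510.20493, arXiv:2603.20776,
arXiv:2605.06844 — kinetic /
Neumann localisation and trial states, no thermodynamic-limit sector spectra); `lit search --source
crossref` ×3 ("excitation
spectrum dilute Bose gas beyond Gross-Pitaevskii" → doi:10.1142/s0129055x22500271,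
doi:10.1007/s00220-024-05199-w Brooks 2024,
doi:10.1016/j.matpur.2023.06.002; "energy-momentum spectrum homogeneous Bose gas critical velocity
rigorous" →
doi:10.1063/1.3129489 = CorneanDerezinskiZin2009, doi:10.1007/s00023-012-0185-9 (Fermi analogue);
"Bogoliubov theory thermodynamic
limit … lower bound" → doi:10.4171/8ecm/04 Nam 8ECM survey, doi:10.1088/1742-6596/3264/1/012001);
`lit vsearch` (sector lower bound
⇒ n_k bound ⇒ BEC phrasing, --no-graph: 10 textbooks only — Griffin1993 pp. 188–189, Pethick–Smith,
Lieb–Seiringer 2010,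
Benedikter–Porta–Schlein 2016); `lit galaxy search --star all` ×3 ("Landau criterion implies
Bose-Einstein condensation",
"energy-momentum spectrum of the Bose gas", "critical velocity in the Bose gas": 0/0/0) and `--star
pdf --mode bm25` "momentum
distribution of an interacting Bose gas" (15 physics hits: Beliaev-technique QMC arXiv:0911.5383,
Pilati–Giorgini–Prokof'ev; nothing
rigorous); plus the card's and novelty audits 4/14/30/32/35 searches (inherited, ids on the card:
seat 35 found Cornea  [refs: 10.1142/s0129055x22500271, 10.1007/s00220-024-05199-w, 10.1016/j.matpur.2023.06.002, 10.1063/1.3129489, 10.1007/s00023-012-0185-9, 10.4171/8ecm/04, 10.1088/1742-6596/3264/1/012001, 10.1007/bf01325630, 2510.20493, 2603.20776, 2605.06844, 0911.5383, math-ph/0511007, doi:10.1142/s0129055x22500271, doi:10.1007/s00220-024-05199-w, doi:10.1016/j.matpur.2023.06.002, doi:10.1063/1.3129489, doi:10.1007/s00]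

Barriers (technique_class: sum-rules infrared-bound spectral-gap zero-temperature): - technique_class: sum-rules infrared-bound spectral-gap zero-temperature
- Literature.Barriers.AtomisticToContinuum.KineticGapLengthScales: evaded in the implication — no
step of the form depletion ≤ L² × (excess energy); each mode pays 1/Γ_N(k) of its OWN sector and
Σ_(0<|k|≤K)(k²+ρ‖v‖₁)/k² converges relative to N in d = 3; δ is chosen AFTER N, below the
Galilei-boost window 4π²N/L² of KineticGapLengthScalesNarrow (exists_decondensed_within_gap), and
the infrared input is a double-commutator inequality against sector minima — "minimality of the true
ground state beyond the value E₀ (double-commutator inequalities, sum rules)", which the narrowed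
block lists as NOT bound. Honest: the barrier can re-enter inside a proof of SectorGapFloor that
localises in space, which is why the crux is pointed at ground-state-representation / sector
technology.
- Literature.Barriers.AtomisticToContinuum.EnergyAsymptoticsWithoutCondensation: evaded — the only
energy input is E₀ ≤ ½ρ‖v‖₁N (constant trial state) for the UV Chebyshev tail (hard cores: Dyson's
leading-order bound); the eigen-equation / sector structure, not energy precision, excludes
fragmented P = 0 impostors; the inference is d = 3-specific (infrared summability), outside the
narrowed two-order dimension-independent class, and the 1-D Lieb–Liniger witness is reproduced (mode
count Σ|k|⁻² diverges relative to N in d = 1).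
- Literature.Barriers.AtomisticToContinuum.BogoliubovPerturbationInfrared: not an expansion —
Bogoliubov ent

History (route lifecycle, newest last):
- 2026-08-25T01:34:39Z · DORMANT — reconciler: no traction for 7.3 d (last activity item-evidence-added at 2026-08-17T18:55:01Z); parked, not closed — `ledger route dormant route-AtomisticToConti (operator:999:3940278)

sub-problem: BoseEinsteinCondensation · status: dormant · opened planner-plancard-AtomisticToContinuum-BoseEin-e1de769a-g2-0 2026-08-15T18:44:37Z · rev 1 · ledger route-AtomisticToContinuum-BECNoCheapMomentum
GENERATED by the gate from the ledger (D-0016/17). Provers cite these decls: `theorem foo : Summit.AtomisticToContinuum.BoseEinsteinCondensation.Theses.BECNoCheapMomentum.<Decl> := …` in Summits/AtomisticToContinuum/BoseEinsteinCondensation/Theorems/<Name>.lean.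
-/

namespace Summit.AtomisticToContinuum.BoseEinsteinCondensation.Theses.BECNoCheapMomentum

open scoped BigOperators Topology Manifold Classical MeasureTheory ProbabilityTheory Matrix InnerProductSpace ComplexConjugate ContinuousMap
open Filter Set Function TopologicalSpace MeasureTheory

attribute [summit_statement] _root_.BoseEinsteinCondensation

/-- item stmt-AtomisticToContinuum-11843 · crux · rank 2 · open · by planner
why it might fail: A TL spectral floor uniform in L: rigorous sector spectra exist only in GP/mean-field scaling (BoccatoEtAl2019Acta; BrenneckeCaporalettiSchlein2022 'still open'); hides near-convexity E₀(N+1)+E₀(N−1)−2E₀(N) ≥ −o(c_s/L); dies on any soft non-phonon branch or c.o.m. tower with Γ/k² → 0 in the window.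
sources: CorneanDerezinskiZin2009, Stringari1995, BoccatoEtAl2019Acta, BrenneckeCaporalettiSchlein2022, Seiringer2011, DerezinskiNapiorkowski2014
[crux] NCMS_κ, particle–hole form (card N1): for every repulsive finite-range v with ∫v(|x|)dx ≠ 0
and every C > 0 there are κ > 0, ρ₀ > 0 such that for ρ ∈ (0,ρ₀), eventually in N, for every k ≠ 0
with ‖k‖² ≤ Cρ: 2E₀^per(N,L) + 2κ‖k‖² ≤ E^per_(N+1)(k;L) + E^per_(N−1)(k;L), L = (N/ρ)^(1/3),
E^per_M(k;L) = inf periodicEnergy over Bloch-k periodic M-body states (⊤ off the dual lattice, so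
only k ∈ (2π/L)ℤ³ bind). Bogoliubov value: Γ ≈ 2c_s|k| + 8πa/L³ on the window (c_s = (16πaρ)^(1/2);
multi-phonon hull), so κ = ½(16πa/C)^(1/2) works; the free gas (Γ = 4π|k|/L) is correctly excluded
by ∫v ≠ 0. Verbatim the signature of retired stmt-5149 and of the conclusion of
BECSectorPoincareTwoScale.LandauFloorToSectorGap (stmt-9096). [difficulty: open-problem] -/
@[route_item "route-AtomisticToContinuum-BECNoCheapMomentum", crux]
def SectorGapFloor : Prop :=
  ∀ v : ℝ → ENNReal, Literature.MathematicalPhysics.QuantumManyBody.BoseGas.IsRepulsiveFiniteRange v → (∫⁻ x : EuclideanSpace ℝ (Fin 3), v ‖x‖) ≠ 0 → ∀ C : ℝ, 0 < C → ∃ κ : ℝ, 0 < κ ∧ ∃ ρ₀ : ℝ, 0 < ρ₀ ∧ ∀ ρ : ℝ, 0 < ρ → ρ < ρ₀ → ∀ᶠ N : ℕ in Filter.atTop, ∀ k : EuclideanSpace ℝ (Fin 3), k ≠ 0 → ‖k‖ ^ 2 ≤ C * ρ → 2 * Literature.MathematicalPhysics.QuantumManyBody.BoseGas.periodicGroundStateEnergy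 v N (Literature.MathematicalPhysics.QuantumManyBody.BoseGas.sideLength ρ N) + ENNReal.ofReal (2 * κ * ‖k‖ ^ 2) ≤ (⨅ (Ψ : Literature.MathematicalPhysics.QuantumManyBody.BoseGas.PeriodicTrialState (N + 1) (Literature.MathematicalPhysics.QuantumManyBody.BoseGas.sideLength ρ N)) (_ : ∀ (s : EuclideanSpace ℝ (Fin 3)) (X : Fin (N + 1) → EuclideanSpace ℝ (Fin 3)), Ψ.ψ (fun i => X i + s) = Complex.exp (Complex.I * ↑(∑ j, k j * s j)) * Ψ.ψ X), Literature.MathematicalPhysics.QuantumManyBody.BoseGas.periodicEnergy v Ψ) + (⨅ (Ψ : Literature.MathematicalPhysics.QuantumManyBody.BoseGas.PeriodicTrialState (N - 1) (Literature.MathematicalPhysics.QuantumManyBody.BoseGas.sideLength ρ N)) (_ : ∀ (s : EuclideanSpace ℝ (Fin 3)) (X : Fin (N - 1) → EuclideanSpace ℝ (Fin 3)), Ψ.ψ (fun i => X i + s) = Complex.exp (Complex.I * ↑(∑ j, k j * s j)) * Ψ.ψ X), Literature.MathematicalPhysics.QuantumManyBody.BoseGas.periodicEnergy v Ψ)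

/-- item stmt-AtomisticToContinuum-11844 · crux · rank 3 · open · by planner
why it might fail: Bare a_k†Ψ₀ leaves the form domain (⟨[[a,V],a†]⟩ = ρv̂(0) = ∞); the Jastrow-dressed double commutator has 3-body terms and [A,A†] ≠ 1, with no printed estimate uniform in N — the dressing error CN(ρR³)^{1/2} must beat N/2 with a ≪ R ≪ ρ^{−1/3}.
sources: LSSY2005, Dyson1957, Stringari1995, LiebSeiringerYngvason2000, LiebYngvason1998
[crux] the non-integrable case of the chain (card N2 hard-core flag): for repulsive finite-range v
with ∫v(|x|)dx = ∞ (hard cores, r^(−3)-type cores), the SectorGapFloor conclusion for v implies the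
PeriodicBEC body for v (constant-mode occupation ≥ cN for δ-near-minimisers on the torus of side
(N/ρ)^(1/3), all small ρ, δ after N). Intended proof: replace a_k† by the Jastrow/Dyson-dressed
creation a†(φ_k ∏_j f(x−x_j)) (zero-energy scattering solution f, cut at a ≪ R ≪ ρ^(−1/3)) so that
the dressed double commutator is ≤ k²(1+CρR³) + Cρa, bound the dressed occupations by the sector gap
as in the soft case, control |n₀ − ñ₀| ≤ CN(ρR³)^(1/2), and take the UV tail from a Dyson-type bound
E₀ ≤ CρaN (LSSY2005 Thm 2.2); zero-momentum uniqueness of the hard-core torus ground state at low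
density (connected configuration space) is part of the item. [deps: SectorGapFloor] [difficulty: L] -/
@[route_item "route-AtomisticToContinuum-BECNoCheapMomentum", crux]
def HardCoreMomentBound : Prop :=
  ∀ v : ℝ → ENNReal, Literature.MathematicalPhysics.QuantumManyBody.BoseGas.IsRepulsiveFiniteRange v → (∫⁻ x : EuclideanSpace ℝ (Fin 3), v ‖x‖) = ⊤ → (∀ C : ℝ, 0 < C → ∃ κ : ℝ, 0 < κ ∧ ∃ ρ₀ : ℝ, 0 < ρ₀ ∧ ∀ ρ : ℝ, 0 < ρ → ρ < ρ₀ → ∀ᶠ N : ℕ in Filter.atTop, ∀ k : EuclideanSpace ℝ (Fin 3), k ≠ 0 → ‖k‖ ^ 2 ≤ C * ρ → 2 * Literature.MathematicalPhysics.QuantumManyBody.BoseGas.periodicGroundStateEnergy v N (Literature.MathematicalPhysics.QuantumManyBody.BoseGas.sideLength ρ N) + ENNReal.ofReal (2 * κ * ‖k‖ ^ 2) ≤ (⨅ (Ψ : Literature.MathematicalPhysics.QuantumManyBody.BoseGas.PeriodicTrialState (N + 1) (Literature.MathematicalPhysics.QuantumManyBody.BoseGas.sideLength ρ N)) (_ :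 ∀ (s : EuclideanSpace ℝ (Fin 3)) (X : Fin (N + 1) → EuclideanSpace ℝ (Fin 3)), Ψ.ψ (fun i => X i + s) = Complex.exp (Complex.I * ↑(∑ j, k j * s j)) * Ψ.ψ X), Literature.MathematicalPhysics.QuantumManyBody.BoseGas.periodicEnergy v Ψ) + (⨅ (Ψ : Literature.MathematicalPhysics.QuantumManyBody.BoseGas.PeriodicTrialState (N - 1) (Literature.MathematicalPhysics.QuantumManyBody.BoseGas.sideLength ρ N)) (_ : ∀ (s : EuclideanSpace ℝ (Fin 3)) (X : Fin (N - 1) → EuclideanSpace ℝ (Fin 3)), Ψ.ψ (fun i => X i + s) = Complex.exp (Complex.I * ↑(∑ j, k j * s j)) * Ψ.ψ X), Literature.MathematicalPhysics.QuantumManyBody.BoseGas.periodicEnergy v Ψ)) → ∃ ρ₀ : ℝ, 0 < ρ₀ ∧ ∀ ρ : ℝ, 0 < ρ → ρ < ρ₀ → ∃ c : ℝ, 0 < c ∧ ∀ᶠ N : ℕ in Filter.atTop, ∃ δ : ENNReal, 0 < δ ∧ ∀ Ψ : Literature.MathematicalPhysics.QuantumManyBody.BoseGas.PeriodicTrialState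 N (Literature.MathematicalPhysics.QuantumManyBody.BoseGas.sideLength ρ N), Literature.MathematicalPhysics.QuantumManyBody.BoseGas.periodicEnergy v Ψ ≤ Literature.MathematicalPhysics.QuantumManyBody.BoseGas.periodicGroundStateEnergy v N (Literature.MathematicalPhysics.QuantumManyBody.BoseGas.sideLength ρ N) + δ → ENNReal.ofReal (c * N) ≤ Literature.MathematicalPhysics.QuantumManyBody.BoseGas.condensateOccupation N (Literature.MathematicalPhysics.QuantumManyBody.BoseGas.sideLength ρ N) Ψ.ψ

/-- item stmt-AtomisticToContinuum-0827 · crux · rank 4 · open · by planner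
why it might fail: The torus hypothesis never fires on the Dirichlet ground state (wall energy ≫ δ above E₀^per; interior restrictions are neither periodic nor sharp-N): no energy-comparison proof; needs a structural transfer (Neumann bracketing + mode-free λ_max ≥ tr γ²/N) not in print.
sources: LSSY2005, BoccatoSeiringer2023, Basti2022, Junge2026, Robinson1976, Fournais2020
[crux] BoundaryTransferWeak (mode-free boundary-condition transfer, per potential): for each
repulsive finite-range v, PeriodicBEC(v) implies ∃ρ₀>0 ∀ρ∈(0,ρ₀) HasGroundStateBEC v ρ (Dirichlet
ground state, λ_max(γ) ≥ cN via condensateNumber). Not glue: near-minimiser slacks are O(N/L²) while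
Dirichlet/periodic energies differ by a boundary term ≫ N/L², so no energy-comparison proof;
expected route: Neumann bracketing of interior sub-boxes (−Δ_Dir ≥ ⊕−Δ_Neu, v ≥ 0) + a mode-free
criterion (λ_max ≥ tr γ²/N). Only the ENERGY analogue is in print (LiebSeiringerSolovejYngvason2005
Ch. 2 after (2.8)). v ≡ 0: hypothesis and conclusion both true. -/
@[route_item "route-AtomisticToContinuum-BECNoCheapMomentum", crux]
def BoundaryTransferWeak : Prop :=
  ∀ v : ℝ → ENNReal, Literature.MathematicalPhysics.QuantumManyBody.BoseGas.IsRepulsiveFiniteRange v → (∃ ρ₀ : ℝ, 0 < ρ₀ ∧ ∀ ρ : ℝ, 0 < ρ → ρ < ρ₀ → ∃ c : ℝ, 0 < c ∧ ∀ᶠ N : ℕ in Filter.atTop, ∃ δ : ENNReal, 0 < δ ∧ ∀ Ψ : Literature.MathematicalPhysics.QuantumManyBody.BoseGas.PeriodicTrialState N (Literature.MathematicalPhysics.QuantumManyBody.BoseGas.sideLength ρ N), Literature.MathematicalPhysics.QuantumManyBody.BoseGas.periodicEnergy v Ψ ≤ Literature.MathematicalPhysics.QuantumManyBody.BoseGas.periodicGroundStateEnergy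 v N (Literature.MathematicalPhysics.QuantumManyBody.BoseGas.sideLength ρ N) + δ → ENNReal.ofReal (c * N) ≤ Literature.MathematicalPhysics.QuantumManyBody.BoseGas.condensateOccupation N (Literature.MathematicalPhysics.QuantumManyBody.BoseGas.sideLength ρ N) Ψ.ψ) → ∃ ρ₀ : ℝ, 0 < ρ₀ ∧ ∀ ρ : ℝ, 0 < ρ → ρ < ρ₀ → Literature.MathematicalPhysics.QuantumManyBody.BoseGas.HasGroundStateBEC v ρ

/-- item stmt-AtomisticToContinuum-11845 · support · rank 9 · closed · proved by Summit.AtomisticToContinuum.BoseEinsteinCondensation.Theorems.zeroMomentumGround_proof (prover) · by planner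
sources: ReedSimonIV1978, CorneanDerezinskiZin2009
[support] qualitative zero-momentum gap at fixed (N, L) for integrable v (Perron–Frobenius): for
repulsive finite-range v with ∫v(|x|)dx < ∞, every N, every L > 0 and every q ≠ 0, E₀^per(N,L) <
E^per_N(q;L) (strict; ⊤ on the right off the dual lattice; N = 0 holds because the Bloch-q class is
empty). Proof: the constant state bounds E₀^per ≤ N(N−1)‖v‖₁/(2L³) < ∞; compact resolvent on the
torus and positivity-improving e^(−tH) for 0 ≤ V ∈ L¹_loc (ReedSimonIV1978 XIII.44–47, XIII.12; C¹
is a form core) ⇒ unique positive, hence Bose-symmetric and translation-invariant, ground state; a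
minimising Bloch-q sequence with energy → E₀ would converge (compactness, lower semicontinuity) to a
Bloch-q ground state, orthogonal to the Bloch-0 one — contradiction. Heavy in Lean (no many-body
operators in Mathlib) but no open mathematics; wanted also by the positivity cards. [difficulty: XL] -/
@[route_item "route-AtomisticToContinuum-BECNoCheapMomentum", crux]
def ZeroMomentumGround : Prop :=
  ∀ v : ℝ → ENNReal, Literature.MathematicalPhysics.QuantumManyBody.BoseGas.IsRepulsiveFiniteRange v → (∫⁻ x : EuclideanSpace ℝ (Fin 3), v ‖x‖) ≠ ⊤ → ∀ (N : ℕ) (L : ℝ), 0 < L → ∀ q : EuclideanSpace ℝ (Fin 3), q ≠ 0 → Literature.MathematicalPhysics.QuantumManyBody.BoseGas.periodicGroundStateEnergy v N L < ⨅ (Ψ : Literature.MathematicalPhysics.QuantumManyBody.BoseGas.PeriodicTrialState N L) (_ : ∀ (s : EuclideanSpace ℝ (Fin 3)) (X : Fin N → EuclideanSpace ℝ (Fin 3)), Ψ.ψ (fun i => X i + s) = Complex.exp (Complex.I * ↑(∑ j, q j * s j)) * Ψ.ψ X), Literature.MathematicalPhysics.QuantumManyBody.BoseGas.periodicEnergy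 v Ψ

/-- item stmt-AtomisticToContinuum-11846 · support · rank 9 · closed · proved by Summit.AtomisticToContinuum.BoseEinsteinCondensation.Theorems.momentBoundCondensation_proof (prover) · by planner
sources: Stringari1995, Wagner1966, PitaevskiiStringari1991, Roepstorff1978, KennedyLiebShastry1988, CorneanDerezinskiZin2009
[support] the card's theorem-shaped half (N2+N3), integrable v ≢ 0: ZeroMomentumGround-body(v) →
SectorGapFloor-body(v) → PeriodicBEC-body(v) with c = 1/2. Proof (operator-free, C¹-form level, δ
chosen after N): decompose a δ-near-minimiser Ψ into centre-of-mass Fourier sectors Ψ = ΣΨ_q (C¹,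
form-orthogonal); ZMG and T ≥ |P|²/N give g_N := inf_(q≠0)(E_N(q) − E₀) > 0 and Σ_(q≠0)‖Ψ_q‖² ≤
δ/g_N; for Φ = Ψ_0/‖Ψ_0‖ use the first-quantised a(φ_k), a†(φ_k) (as in `occupation`): Q_(N−1)(aΦ) ≥
E_(N−1)(k)n_k (E_(N−1)(−k) = E_(N−1)(k) by conjugation), Q_(N+1)(a†Φ) ≥ E_(N+1)(k)(n_k+1) (and
E_(N+1)(k) ≥ E₀(N+1) ≥ E₀(N) lets the extra +1 be dropped), the identity Q_(N−1)(aΦ) + Q_(N+1)(a†Φ)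
= ⟨[[a,H],a†]⟩_Φ + 2Re(Q_N − E₀)(Φ, n̂_kΦ) + (Q_N(Φ) − E₀) with the error ≤
2(δ′·C(N,L,k,‖v‖₁))^(1/2) + δ′ by Cauchy–Schwarz for the non-negative form Q_N − E₀ (n̂_kΦ stays in
the form domain because v ∈ L¹), and ⟨[[a_k,H],a_k†]⟩_Φ = k² + L⁻³(v̂(0)N + Σ_q v̂(q−k)n_q) ≤ k² +
2ρ‖v‖₁; hence n_k ≤ (k² + 2ρ‖v‖₁ + err_k)/(2κk²) on the window C = 4‖v‖₁; Parseval Σ_k n_k = N, Σ_k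
k²n_k = T ≤ E₀ + δ′ ≤ ½ρ‖v‖₁N + δ′ (constant trial state) give the UV tail Σ_(|k|²>Cρ) n_k ≤ N/8 +
o(1), and the d = 3 lattice count (#{0<|k -/
@[route_item "route-AtomisticToContinuum-BECNoCheapMomentum", crux]
def MomentBoundCondensation : Prop :=
  ∀ v : ℝ → ENNReal, Literature.MathematicalPhysics.QuantumManyBody.BoseGas.IsRepulsiveFiniteRange v → (∫⁻ x : EuclideanSpace ℝ (Fin 3), v ‖x‖) ≠ ⊤ → (∫⁻ x : EuclideanSpace ℝ (Fin 3), v ‖x‖) ≠ 0 → (∀ (N : ℕ) (L : ℝ), 0 < L → ∀ q : EuclideanSpace ℝ (Fin 3), q ≠ 0 → Literature.MathematicalPhysics.QuantumManyBody.BoseGas.periodicGroundStateEnergy v N L < ⨅ (Ψ : Literature.MathematicalPhysics.QuantumManyBody.BoseGas.PeriodicTrialState N L) (_ : ∀ (s : EuclideanSpace ℝ (Fin 3)) (X : Fin N → EuclideanSpace ℝ (Fin 3)), Ψ.ψ (fun i => X i + s) = Complex.exp (Complex.I * ↑(∑ j, q j * s j)) * Ψ.ψ X), Literature.MathematicalPhysics.QuantumManyBody.BoseGas.periodicEnergy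 v Ψ) → (∀ C : ℝ, 0 < C → ∃ κ : ℝ, 0 < κ ∧ ∃ ρ₀ : ℝ, 0 < ρ₀ ∧ ∀ ρ : ℝ, 0 < ρ → ρ < ρ₀ → ∀ᶠ N : ℕ in Filter.atTop, ∀ k : EuclideanSpace ℝ (Fin 3), k ≠ 0 → ‖k‖ ^ 2 ≤ C * ρ → 2 * Literature.MathematicalPhysics.QuantumManyBody.BoseGas.periodicGroundStateEnergy v N (Literature.MathematicalPhysics.QuantumManyBody.BoseGas.sideLength ρ N) + ENNReal.ofReal (2 * κ * ‖k‖ ^ 2) ≤ (⨅ (Ψ : Literature.MathematicalPhysics.QuantumManyBody.BoseGas.PeriodicTrialState (N + 1) (Literature.MathematicalPhysics.QuantumManyBody.BoseGas.sideLength ρ N)) (_ : ∀ (s : EuclideanSpace ℝ (Fin 3)) (X : Fin (N + 1) → EuclideanSpace ℝ (Fin 3)), Ψ.ψ (fun i => X i + s) = Complex.exp (Complex.I * ↑(∑ j, k j * s j)) * Ψ.ψ X), Literature.MathematicalPhysics.QuantumManyBody.BoseGas.periodicEnergy v Ψ) + (⨅ (Ψ : Literature.MathematicalPhysics.QuantumManyBody.BoseGas.PeriodicTrialState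 (N - 1) (Literature.MathematicalPhysics.QuantumManyBody.BoseGas.sideLength ρ N)) (_ : ∀ (s : EuclideanSpace ℝ (Fin 3)) (X : Fin (N - 1) → EuclideanSpace ℝ (Fin 3)), Ψ.ψ (fun i => X i + s) = Complex.exp (Complex.I * ↑(∑ j, k j * s j)) * Ψ.ψ X), Literature.MathematicalPhysics.QuantumManyBody.BoseGas.periodicEnergy v Ψ)) → ∃ ρ₀ : ℝ, 0 < ρ₀ ∧ ∀ ρ : ℝ, 0 < ρ → ρ < ρ₀ → ∃ c : ℝ, 0 < c ∧ ∀ᶠ N : ℕ in Filter.atTop, ∃ δ : ENNReal, 0 < δ ∧ ∀ Ψ : Literature.MathematicalPhysics.QuantumManyBody.BoseGas.PeriodicTrialState N (Literature.MathematicalPhysics.QuantumManyBody.BoseGas.sideLength ρ N), Literature.MathematicalPhysics.QuantumManyBody.BoseGas.periodicEnergy v Ψ ≤ Literature.MathematicalPhysics.QuantumManyBody.BoseGas.periodicGroundStateEnergy v N (Literature.MathematicalPhysics.QuantumManyBody.BoseGas.sideLength ρ N) + δ → ENNReal.ofReal (c * N) ≤ Literature.MathematicalPhysics.QuantumManyBody.BoseGas.condensateOccupation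 N (Literature.MathematicalPhysics.QuantumManyBody.BoseGas.sideLength ρ N) Ψ.ψ

/-- item stmt-AtomisticToContinuum-11847 · support · rank 9 · closed · proved by Summit.AtomisticToContinuum.BoseEinsteinCondensation.Theorems.freeGasCondensation_proof (prover) · by planner
sources: LSSY2005, PenroseOnsager1956
[support] the a.e.-free gas (∫v(|x|)dx = 0, where SectorGapFloor's hypothesis fails and is not
assumed) condenses on the torus: v^per = 0 a.e., so periodicEnergy = kinetic energy and E₀^per = 0
(constant state); for a δ-near-minimiser Σ_(k≠0) n_k ≤ T(L/2π)² ≤ δL²/4π², so δ = 2π²/L² gives n₀ ≥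
N − ½ ≥ N/2 (Parseval in one variable inside the product, Bessel for the gradient); c = 1/2, any ρ₀.
[difficulty: M] -/
@[route_item "route-AtomisticToContinuum-BECNoCheapMomentum", crux]
def FreeGasCondensation : Prop :=
  ∀ v : ℝ → ENNReal, Literature.MathematicalPhysics.QuantumManyBody.BoseGas.IsRepulsiveFiniteRange v → (∫⁻ x : EuclideanSpace ℝ (Fin 3), v ‖x‖) = 0 → ∃ ρ₀ : ℝ, 0 < ρ₀ ∧ ∀ ρ : ℝ, 0 < ρ → ρ < ρ₀ → ∃ c : ℝ, 0 < c ∧ ∀ᶠ N : ℕ in Filter.atTop, ∃ δ : ENNReal, 0 < δ ∧ ∀ Ψ : Literature.MathematicalPhysics.QuantumManyBody.BoseGas.PeriodicTrialState N (Literature.MathematicalPhysics.QuantumManyBody.BoseGas.sideLength ρ N), Literature.MathematicalPhysics.QuantumManyBody.BoseGas.periodicEnergy v Ψ ≤ Literature.MathematicalPhysics.QuantumManyBody.BoseGas.periodicGroundStateEnergy v N (Literature.MathematicalPhysics.QuantumManyBody.BoseGas.sideLength ρ N) + δ → ENNReal.ofReal (c * N) ≤ Literature.MathematicalPhysics.QuantumManyBody.BoseGas.condensateOccupation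 N (Literature.MathematicalPhysics.QuantumManyBody.BoseGas.sideLength ρ N) Ψ.ψ

/-- item stmt-AtomisticToContinuum-11848 · assembly · rank 1 · closed · proved by Summit.AtomisticToContinuum.BoseEinsteinCondensation.Theorems.becNoCheapMomentum_assembly_proof (prover) · by planner
sources: LSSY2005, Stringari1995, CorneanDerezinskiZin2009
[assembly] SectorGapFloor → HardCoreMomentBound → BoundaryTransferWeak → ZeroMomentumGround →
MomentBoundCondensation → FreeGasCondensation → BoseEinsteinCondensation. -/
@[route_item "route-AtomisticToContinuum-BECNoCheapMomentum"]
def Assembly : Prop :=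
  SectorGapFloor → HardCoreMomentBound → BoundaryTransferWeak → ZeroMomentumGround → MomentBoundCondensation → FreeGasCondensation → BoseEinsteinCondensation

/-! D-0027 §2.1 — DECIDING THEOREM (planner-authored via `route open/edit --closes-file`; by planner-plancard-AtomisticToContinuum-BoseEin-e1de769a-g2-0 2026-08-15T18:44:39Z):
its hypotheses are this route's items and its conclusion the sub-problem Statement (glue_lint), and it elaborates with this file. -/

@[closes "route-AtomisticToContinuum-BECNoCheapMomentum"] theorem closes (h1 : SectorGapFloor) (h2 : HardCoreMomentBound) (h3 : BoundaryTransferWeak)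
    (h4 : ZeroMomentumGround) (h5 : MomentBoundCondensation) (h6 : FreeGasCondensation) :
    BoseEinsteinCondensation := by
  intro v hv
  refine h3 v hv ?_
  by_cases h0 : (∫⁻ x : EuclideanSpace ℝ (Fin 3), v ‖x‖) = 0
  · exact h6 v hv h0
  · by_cases htop : (∫⁻ x : EuclideanSpace ℝ (Fin 3), v ‖x‖) = ⊤
    · exact h2 v hv htop (h1 v hv h0)
    · exact h5 v hv htop h0 (h4 v hv htop) (h1 v hv h0)

end Summit.AtomisticToContinuum.BoseEinsteinCondensation.Theses.BECNoCheapMomentum
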